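import Mathlib
import HarnessLib
import Summits.HubbardSuperconductivity.HubbardSuperconductivity.Theorems.KLProgrammeKLRegimeEngineLastStepTwoLegReadOfPosC2
import Summits.HubbardSuperconductivity.HubbardSuperconductivity.Theorems.KLProgrammeKLRegimeCountertermJacksonRemainderCertAnFitKlEng
import Summits.HubbardSuperconductivity.HubbardSuperconductivity.Theorems.KLProgrammeKLRegimeCountertermJacksonRemainderReadResidueC1TabFitA
import Summits.HubbardSuperconductivity.HubbardSuperconductivity.Theorems.KLProgrammeKLRegimeSplitGenericV3

/-!
# K3 gen-8-FLOW (stmt 20437, stub (C) `stub_twoLeg_curvature`, located item #20 (δ′)): «LAST-ALL-DOORS» — the LAST-INDEX registered two-leg pair with the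
# (R) response, (T) transport AND (C1) Jackson-remainder brackets ALL DISCHARGED BY NAME, at stub (C)'s binders (cell gate-hubbard-kl, seat p2 g23)

= this seat's `twoLegRead_flow_last_registered_of_pos_c2` (p661056 = p2 g21's p649639 ∘ «(C2)-ONE-CALL» at `n := n_β`) ∘ the (C1) door at `n := n_β` keyed on the
PRIVATE induction hypothesis `TwoLegReadJetBound L M pc pc′ β U μ K_{n_β} n_β` (the tables the private induction carried to the last-but-one index; renamed
`pc, pc′` here because `cc` is E1's time-weighted two-leg constant of the (R) door):
* **`twoLegRead_flow_last_registered_deep`** (`5 ≤ n_β`): (C1) := `readResidueC1_hJ_analytic_klEng` (`KlwjCertA`; `eJ := klC1AnFit pc`, `eJ′ := klC1AnFit′ pc pc′`;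
  the KL-regime clause at `n_β + 1` from `isKLRegime_of_le_nScales_succ`);
* **`twoLegRead_flow_last_registered_table`** (`n_β + 1 ≤ 21`): (C1) := `readResidueC1_hJ_of_twoLegReadJetBound_klEng` (certificate
  `CutoffDefectCertFrame (klFlowDeg n_β) A T`), below any `eJ, eJ′` above its linear forms (`curveJetBar_mono_at`).
Stub binders `R.WF`, `0 < c ≤ klEngC₃6 P R`, `0 < U ≤ klEngU₀9 P R c` (curve-regime thresholds derived).  What the closer feeds at the last index: `FrameOK` of
`K_{n_β}` and `K_{n_β+1}` at depth `n_β`, the full flow history, the (R) door's envelopes and E1's four constants `cb cbs cc ccs` + two U-rows, the #17 export `z` at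
`n_β + 1` with rows `mT` and a primed table `eT′`, the certificate, the private IH at `n_β`, (A)-OLD-FRAME `hA/hAval` (c4a-1), and the three REGISTERED fits
(deep: `cA k + ((0|1) + klC1AnFit pc k) ≤ klC4aJetC2 k`, `cA′ k + ((1|0) + eT′ k + klC1AnFit′ pc pc′ k) ≤ klC4aJetC′ P R k`, `2(a + (1 + eT′ 0 + klC1AnFit′ pc pc′ 0)) ≤
klReadOscC P R`).  OUTPUT: `TwoLegReadJetBound L M klC4aJetC2 (klC4aJetC′ P R) … K_{n_β+1} (n_β+1) ∧ TwoLegReadOscAt L M (klReadOscC P R) … K_{n_β+1} (n_β+1)` —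
the driver's `hlast`.

Compositions only; no definitions; nothing asserts any stub of 20437, K3, the margin or superconductivity.  Refs: BGM 2006 §2.4 Lemma 2.1 (2.36)–(2.42)
[cite: BenfattoGiulianiMastropietro2006]; FST 1996 §1 [cite: FeldmanSalmhoferTrubowitz1996].
-/

noncomputable section

namespace Summit.HubbardSuperconductivity.HubbardSuperconductivity.Theorems.EngineV8

set_option linter.dupNamespace false -- summit = problem name (single-conjunct summit), D-0017
set_option exponentiation.threshold 512 -- the graded alias-tail constant is `2^282`

open Complex Real Finset Filter Literature.MathematicalPhysics.QuantumLattice Literature.Probability.LatticeModels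
open Literature.MathematicalPhysics.QuantumLattice.BandSectorCounting
open Literature.Analysis.Fourier Literature.Analysis.Calculus
open Summit.HubbardSuperconductivity.HubbardSuperconductivity.Theorems.KLRegimeSplit
open Summit.HubbardSuperconductivity.HubbardSuperconductivity.Theorems.DispersionFlow
open Summit.HubbardSuperconductivity.HubbardSuperconductivity.Theorems.KLProgrammeLegKernels
open Summit.HubbardSuperconductivity.HubbardSuperconductivity.Theorems.PerturbedFermiCurve
open scoped Nat

section LastAllDoors

variable {L M : ℕ} [NeZero L] [NeZero M]

/-- **«LAST-ALL-DOORS», deep** (`5 ≤ n_β`): stub (C) v2's REGISTERED pair at `(K_{n_β+1}, n_β+1)` with (R), (T) AND (C1) discharged by name — (C1) :=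
k3c3-p3's analytic branch at `n := n_β` keyed on the PRIVATE induction hypothesis `TwoLegReadJetBound L M pc pc′ … K_{n_β} n_β` (matrix `klC1AnFit`).
Left: (A)-OLD-FRAME `hA/hAval` (c4a-1), E1's `cb cbs cc ccs`/`z`, rows, `eT′`, certificate `KlwjCertA`, the three fits.
[cite: BenfattoGiulianiMastropietro2006, §2.4 Lemma 2.1 (2.36)–(2.42)] -/
theorem twoLegRead_flow_last_registered_deep {P : SplitConsts} {R : RenConsts} (hRW : R.WF) {c : ℝ} (hc : 0 < c) (hc6 : c ≤ klEngC₃6 P R)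
    {U : ℝ} (hU : 0 < U) (hU9 : U ≤ klEngU₀9 P R c) {β : ℝ} (hβmin : klBetaMin ≤ β) (hβc : β ≤ Real.exp (c / U ^ 2)) (hN5 : 5 ≤ nScales β)
    {μ : ℝ} (hμ : μ ∈ klWindowC) (hK : FrameOK R U (nScales β) μ (klFlowFrameU L M β U μ (nScales β)))
    (hK1 : FrameOK R U (nScales β) μ (klFlowFrameU L M β U μ (nScales β + 1))) {G : GeoConsts} {Q : EngConsts} (hGS : ∀ k, 0 ≤ G.S k) (hQS : ∀ k, 0 ≤ Q.S' k) (hR0 : 0 < R.Gfr 0)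
    (hPh : ∀ m ≤ nScales β, FlowPieceJetsAt L M β U μ R m) (hT : ∀ m ≤ nScales β, TwoLegReadJetsF L M G Q β U μ m) {W Ξ Θ : ℝ}
    (hW : W = curveExtC (klChi2CauchyTab2 4) G.S 1 + curveExtC (klChi2CauchyTab2 4) Q.S' 1 * |U|) (hΞ : Ξ = 2 ^ 10 * (1 + Real.pi ^ 8 * (W * U ^ 2) / 2 ^ 11) + ∑ j ∈ range 5, R.Gfr j)
    (hΘ : Θ = 1 + ((∑ j ∈ range 5, R.Gfr j) + Real.pi ^ 8 * W / 2 ^ 11) * |U| / R.Gfr 0)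
    (hdoor : R.Gfr 0 * |U| + ((∑ j ∈ range 5, R.Gfr j) + Real.pi ^ 8 * W / 2 ^ 11) * U ^ 2 ≤ 1 / 512) (hL : klEngL₄ P R β U ≤ L)
    (hZn : IsUnit (effPartitionFn ℂ (normalCovariance L M (uvSymbolCT L M β μ (klFlowFrameU L M β U μ (nScales β + 1)) (klScale klE0 (nScales β + 1))))
      (hubbardInteraction L M β U + counterQuadratic L M β (klFlowFrameU L M β U μ (nScales β + 1)))))
    {s : ℕ} (hs : 10 ≤ s)
    {cb cbs cc ccs : ℝ} (hcb : 0 ≤ cb) (hcbs : 0 ≤ cbs) (hcc : 0 ≤ cc) (hccs : 0 ≤ ccs)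
    (hSb : ∀ m ≤ 4, ∀ (σ : Fin 2) (x₀ : SpaceTimeIdx L M), imagTimeWeight β M *
      ∑ x ∈ (univ : Finset (Fin 2 → SpaceTimeIdx L M)).filter (fun x => x 0 = x₀),
        (1 + ((((x 1).2 - (x 0).2) 0).valMinAbs.natAbs : ℝ) + ((((x 1).2 - (x 0).2) 1).valMinAbs.natAbs : ℝ)) ^ m *
          ‖sectorisedKernel L M β (trivialMultiplier L M) (klEffectiveAction L M β U μ (klFlowFrameU L M β U μ (nScales β + 1)) klE0 (nScales β + 1)) 2
            (![((0, σ), 0), ((0, σ), 1)] : Fin 2 → SectorLeg 1) x‖ ≤ cb * U * ((4 : ℝ) ^ nScales β) ^ m)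
    (hSbs : ∀ (σ : Fin 2) (x₀ : SpaceTimeIdx L M), imagTimeWeight β M *
      ∑ x ∈ (univ : Finset (Fin 2 → SpaceTimeIdx L M)).filter (fun x => x 0 = x₀),
        (1 + ((((x 1).2 - (x 0).2) 0).valMinAbs.natAbs : ℝ) + ((((x 1).2 - (x 0).2) 1).valMinAbs.natAbs : ℝ)) ^ s *
          ‖sectorisedKernel L M β (trivialMultiplier L M) (klEffectiveAction L M β U μ (klFlowFrameU L M β U μ (nScales β + 1)) klE0 (nScales β + 1)) 2
            (![((0, σ), 0), ((0, σ), 1)] : Fin 2 → SectorLeg 1) x‖ ≤ cbs * U * ((4 : ℝ) ^ nScales β) ^ s)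
    (hTc : ∀ m ≤ 4, ∀ (σ : Fin 2) (x₀ : SpaceTimeIdx L M), imagTimeWeight β M *
      ∑ x ∈ (univ : Finset (Fin 2 → SpaceTimeIdx L M)).filter (fun x => x 0 = x₀),
        (1 + ((((x 1).2 - (x 0).2) 0).valMinAbs.natAbs : ℝ) + ((((x 1).2 - (x 0).2) 1).valMinAbs.natAbs : ℝ)) ^ m * (imagTimeWeight β M * (circDist (2 * M) (x 0).1.val (x 1).1.val : ℝ)) *
          ‖sectorisedKernel L M β (trivialMultiplier L M) (klEffectiveAction L M β U μ (klFlowFrameU L M β U μ (nScales β + 1)) klE0 (nScales β + 1)) 2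
            (![((0, σ), 0), ((0, σ), 1)] : Fin 2 → SectorLeg 1) x‖ ≤ cc * U ^ 2 * ((4 : ℝ) ^ nScales β) ^ m)
    (hTcs : ∀ (σ : Fin 2) (x₀ : SpaceTimeIdx L M), imagTimeWeight β M *
      ∑ x ∈ (univ : Finset (Fin 2 → SpaceTimeIdx L M)).filter (fun x => x 0 = x₀),
        (1 + ((((x 1).2 - (x 0).2) 0).valMinAbs.natAbs : ℝ) + ((((x 1).2 - (x 0).2) 1).valMinAbs.natAbs : ℝ)) ^ s * (imagTimeWeight β M * (circDist (2 * M) (x 0).1.val (x 1).1.val : ℝ)) *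
          ‖sectorisedKernel L M β (trivialMultiplier L M) (klEffectiveAction L M β U μ (klFlowFrameU L M β U μ (nScales β + 1)) klE0 (nScales β + 1)) 2
            (![((0, σ), 0), ((0, σ), 1)] : Fin 2 → SectorLeg 1) x‖ ≤ ccs * U ^ 2 * ((4 : ℝ) ^ nScales β) ^ s)
    (hUlast : U ≤ klLastRespU P R) (hUE1 : 32 * klEngRsq R ^ 5 * (2 ^ 234 * cb + 2 ^ 156 * cc + cbs + ccs) * U ≤ 1)
    -- the (P)-receiver's other inputs at the last index (k3c3-p1 `twoLegRead_flow_succ_of_swap_lit_registered`, n := n_β)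
    (hLdeg : 4 * klFlowDeg (nScales β + 1) ≤ L) {cA cA' pc pc' : ℕ → ℝ} {τA a : ℝ} (hpc : ∀ k, 0 ≤ pc k) (hpc' : ∀ k, 0 ≤ pc' k)
    (hA : TwoLegCurveJetBound L M cA cA' β U μ (klFlowFrameU L M β U μ (nScales β)) (nScales β + 1))
    (hAval : ∀ θ : ℝ, |klTwoLegCurveProfile L M β U μ (klFlowFrameU L M β U μ (nScales β)) (nScales β + 1) θ - τA| ≤
      a * U ^ 2 * (4 : ℝ) ^ (-2 * ((nScales β + 1 : ℕ) : ℤ)))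
    -- (T): the #17 export at the LAST index `(K_{n_β+1}, n_β+1)`, five rows (factor `4^{j−1}`), a primed table above `transport_jets_flow_fit`'s
    {z : ℕ → ℝ} (hz : ∀ j, 0 ≤ z j) (hZsp : TwoLegDualSpaceMomentsUpToAt L M (klZspLaw z U (nScales β + 1)) β U μ (nScales β + 1) 5)
    {mT : ℕ → ℝ} (hmT : ∀ j, 0 ≤ mT j)
    (hmT1 : 4 / 3 * R.Gfr 1 + 2 * z 1 ≤ mT 1) (hmT2 : R.Gfr 2 + 8 * z 2 ≤ mT 2) (hmT3 : R.Gfr 3 / 3 + 32 * z 3 ≤ mT 3)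
    (hmT4 : R.Gfr 4 / 15 + 128 * z 4 ≤ mT 4) (hmT5 : 2 ^ 5 * (Real.pi ^ 8 / 4 * 2 ^ 4 * (2 : ℝ) ^ 32) * W / 63 + 512 * z 5 ≤ mT 5)
    {eT' : ℕ → ℝ} (heT : ∀ k ≤ 4,
        (fun k : ℕ =>
          if k = 0 then 16 * ((12.2 * R.Gfr 0 * mT 1))
          else if k = 1 then 4 * ((1420 * 2 * (R.Gfr 1 + R.Gfr 2 + R.Gfr 3 + R.Gfr 4) * (1 + 2 * (R.Gfr 3 + R.Gfr 4)) * mT 1) + (36400 * R.Gfr 0 * mT 1) + (2820 * R.Gfr 0 * mT 2))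
          else if k = 2 then ((12900000 * 2 ^ 2 * (R.Gfr 1 + R.Gfr 2 + R.Gfr 3 + R.Gfr 4) * (1 + 2 * (R.Gfr 3 + R.Gfr 4)) ^ 2 * mT 1) + (657000 * 2 * (R.Gfr 1 + R.Gfr 2 + R.Gfr 3 + R.Gfr 4) * (1 + 2 * (R.Gfr 3 + R.Gfr 4)) * mT 2) + (338000000 * 2 * R.Gfr 0 * (1 + 2 * (R.Gfr 3 + R.Gfr 4)) * mT 1) + (25400000 * R.Gfr 0 * mT 2) + (652000 * R.Gfr 0 * mT 3))
          else if k = 3 then ((199000000000 * 2 ^ 3 * (R.Gfr 1 + R.Gfr 2 + R.Gfr 3 + R.Gfr 4) * (1 + 2 * (R.Gfr 3 + R.Gfr 4)) ^ 3 * mT 1) + (12000000000 * 2 ^ 2 * (R.Gfr 1 + R.Gfr 2 + R.Gfr 3 + R.Gfr 4) * (1 + 2 * (R.Gfr 3 + R.Gfr 4)) ^ 2 * mT 2) + (228000000 * 2 * (R.Gfr 1 + R.Gfr 2 + R.Gfr 3 + R.Gfr 4) * (1 + 2 * (R.Gfr 3 + R.Gfr 4)) * mT 3) + (5230000000000 *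 2 ^ 2 * R.Gfr 0 * (1 + 2 * (R.Gfr 3 + R.Gfr 4)) ^ 2 * mT 1) + (392000000000 * 2 * R.Gfr 0 * (1 + 2 * (R.Gfr 3 + R.Gfr 4)) * mT 2) + (11800000000 * R.Gfr 0 * mT 3) + (151000000 * R.Gfr 0 * mT 4)) / 4
          else if k = 4 then ((4300000000000000 * 2 ^ 4 * (R.Gfr 1 + R.Gfr 2 + R.Gfr 3 + R.Gfr 4) * (1 + 2 * (R.Gfr 3 + R.Gfr 4)) ^ 4 * mT 1) + (276000000000000 * 2 ^ 3 * (R.Gfr 1 + R.Gfr 2 + R.Gfr 3 + R.Gfr 4) * (1 + 2 * (R.Gfr 3 + R.Gfr 4)) ^ 3 * mT 2) + (6890000000000 * 2 ^ 2 * (R.Gfr 1 + R.Gfr 2 + R.Gfr 3 + R.Gfr 4) * (1 + 2 * (R.Gfr 3 + R.Gfr 4)) ^ 2 * mT 3) + (70100000000 * 2 * (R.Gfr 1 + R.Gfr 2 + R.Gfr 3 + R.Gfr 4) * (1 + 2 * (R.Gfr 3 + R.Gfr 4)) * mT 4) + (114000000000000000 * 2 ^ 2 * R.Gfr 0 * (1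 + 2 * (R.Gfr 3 + R.Gfr 4)) ^ 2 * mT 1) + (8490000000000000 * 2 ^ 2 * R.Gfr 0 * (1 + 2 * (R.Gfr 3 + R.Gfr 4)) ^ 2 * mT 2) + (272000000000000 * 2 * R.Gfr 0 * (1 + 2 * (R.Gfr 3 + R.Gfr 4)) * mT 3) + (4530000000000 * R.Gfr 0 * mT 4) + (34800000000 * R.Gfr 0 * mT 5) + (69200000000 * (16 / 15) * R.Gfr 4 * mT 1)) / 16
          else 0) k ≤ eT' k)
    -- (C1): the window certificate of the analytic branch and the PRIVATE induction hypothesis (jets half) at scale n_β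
    (hcertA : KlwjCertA) (hIH : TwoLegReadJetBound L M pc pc' β U μ (klFlowFrameU L M β U μ (nScales β)) (nScales β))
    (hfit : ∀ k, cA k + ((if k = 0 then (0 : ℝ) else 1) + klC1AnFit pc k) ≤ klC4aJetC2 k)
    (hfit' : ∀ k, cA' k + ((if k = 0 then (1 : ℝ) else 0) + eT' k + klC1AnFit' pc pc' k) ≤ klC4aJetC' P R k)
    (hfitO : 2 * (a + (1 + eT' 0 + klC1AnFit' pc pc' 0)) ≤ klReadOscC P R) :
    TwoLegReadJetBound L M klC4aJetC2 (klC4aJetC' P R) β U μ (klFlowFrameU L M β U μ (nScales β + 1)) (nScales β + 1) ∧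
      TwoLegReadOscAt L M (klReadOscC P R) β U μ (klFlowFrameU L M β U μ (nScales β + 1)) (nScales β + 1) := by
  have hR : ∀ j, 0 ≤ R.Gfr j := hRW.2.2
  have hcle : c ≤ klCurveC3 R := hc6.trans ((klEngC₃6_le_klEngC₃3 P R).trans (klEngC₃3_le_klCurveC3 P hR))
  have hUle : U ≤ klCurveU0 R := hU9.trans ((klEngU₀9_le_klEngU₀3 P R c).trans (klEngU₀3_le_klCurveU0 P hR c))
  have hU1 : U ≤ 1 := hUle.trans (klCurveU0_le_one R)
  have hreg : IsKLRegime U c (-((nScales β + 1 : ℕ) : ℤ)) := isKLRegime_of_le_nScales_succ hc.le hβmin hβc le_rfl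
  obtain ⟨hJdiff, hJ⟩ := readResidueC1_hJ_analytic_klEng (L := L) (M := M) hcertA hRW hc hc6 hμ hU hU9 hβmin hβc hN5 hreg hK1
    (fun m hm => hPh m (by omega)) hpc hpc' hIH
  exact twoLegRead_flow_last_registered_of_pos_c2 hR hc hcle hU hU1 hUle hβmin hβc hμ hK hK1 hGS hQS hR0 hPh hT hW hΞ hΘ hdoor hL hZn hs hcb hcbs hcc
    hccs hSb hSbs hTc hTcs hUlast hUE1 hLdeg hA hAval hz hZsp hmT hmT1 hmT2 hmT3 hmT4 hmT5 heT hJdiff hJ (klC1AnFit_zero pc) hfit hfit' hfitO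

/-- **«LAST-ALL-DOORS», table** (`n_β + 1 ≤ 21`): the same with (C1) := k3c3-p1's table branch at a cutoff-defect certificate
`CutoffDefectCertFrame (klFlowDeg n_β) A T` (`A ≥ 10⁻¹²`), read below any tables `eJ, eJ′` dominating its linear forms at `k ≤ 4` (`eJ 0 = 0`).
[cite: BenfattoGiulianiMastropietro2006, §2.4 Lemma 2.1 (2.36)–(2.42)] -/
theorem twoLegRead_flow_last_registered_table {P : SplitConsts} {R : RenConsts} (hRW : R.WF) {c : ℝ} (hc : 0 < c) (hc6 : c ≤ klEngC₃6 P R)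
    {U : ℝ} (hU : 0 < U) (hU9 : U ≤ klEngU₀9 P R c) {β : ℝ} (hβmin : klBetaMin ≤ β) (hβc : β ≤ Real.exp (c / U ^ 2)) (hN21 : nScales β + 1 ≤ 21)
    {μ : ℝ} (hμ : μ ∈ klWindowC) (hK : FrameOK R U (nScales β) μ (klFlowFrameU L M β U μ (nScales β)))
    (hK1 : FrameOK R U (nScales β) μ (klFlowFrameU L M β U μ (nScales β + 1))) {G : GeoConsts} {Q : EngConsts} (hGS : ∀ k, 0 ≤ G.S k) (hQS : ∀ k, 0 ≤ Q.S' k) (hR0 : 0 < R.Gfr 0)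
    (hPh : ∀ m ≤ nScales β, FlowPieceJetsAt L M β U μ R m) (hT : ∀ m ≤ nScales β, TwoLegReadJetsF L M G Q β U μ m) {W Ξ Θ : ℝ}
    (hW : W = curveExtC (klChi2CauchyTab2 4) G.S 1 + curveExtC (klChi2CauchyTab2 4) Q.S' 1 * |U|) (hΞ : Ξ = 2 ^ 10 * (1 + Real.pi ^ 8 * (W * U ^ 2) / 2 ^ 11) + ∑ j ∈ range 5, R.Gfr j)
    (hΘ : Θ = 1 + ((∑ j ∈ range 5, R.Gfr j) + Real.pi ^ 8 * W / 2 ^ 11) * |U| / R.Gfr 0)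
    (hdoor : R.Gfr 0 * |U| + ((∑ j ∈ range 5, R.Gfr j) + Real.pi ^ 8 * W / 2 ^ 11) * U ^ 2 ≤ 1 / 512) (hL : klEngL₄ P R β U ≤ L)
    (hZn : IsUnit (effPartitionFn ℂ (normalCovariance L M (uvSymbolCT L M β μ (klFlowFrameU L M β U μ (nScales β + 1)) (klScale klE0 (nScales β + 1))))
      (hubbardInteraction L M β U + counterQuadratic L M β (klFlowFrameU L M β U μ (nScales β + 1)))))
    {s : ℕ} (hs : 10 ≤ s)
    {cb cbs cc ccs : ℝ} (hcb : 0 ≤ cb) (hcbs : 0 ≤ cbs) (hcc : 0 ≤ cc) (hccs : 0 ≤ ccs)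
    (hSb : ∀ m ≤ 4, ∀ (σ : Fin 2) (x₀ : SpaceTimeIdx L M), imagTimeWeight β M *
      ∑ x ∈ (univ : Finset (Fin 2 → SpaceTimeIdx L M)).filter (fun x => x 0 = x₀),
        (1 + ((((x 1).2 - (x 0).2) 0).valMinAbs.natAbs : ℝ) + ((((x 1).2 - (x 0).2) 1).valMinAbs.natAbs : ℝ)) ^ m *
          ‖sectorisedKernel L M β (trivialMultiplier L M) (klEffectiveAction L M β U μ (klFlowFrameU L M β U μ (nScales β + 1)) klE0 (nScales β + 1)) 2
            (![((0, σ), 0), ((0, σ), 1)] : Fin 2 → SectorLeg 1) x‖ ≤ cb * U * ((4 : ℝ) ^ nScales β) ^ m)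
    (hSbs : ∀ (σ : Fin 2) (x₀ : SpaceTimeIdx L M), imagTimeWeight β M *
      ∑ x ∈ (univ : Finset (Fin 2 → SpaceTimeIdx L M)).filter (fun x => x 0 = x₀),
        (1 + ((((x 1).2 - (x 0).2) 0).valMinAbs.natAbs : ℝ) + ((((x 1).2 - (x 0).2) 1).valMinAbs.natAbs : ℝ)) ^ s *
          ‖sectorisedKernel L M β (trivialMultiplier L M) (klEffectiveAction L M β U μ (klFlowFrameU L M β U μ (nScales β + 1)) klE0 (nScales β + 1)) 2
            (![((0, σ), 0), ((0, σ), 1)] : Fin 2 → SectorLeg 1) x‖ ≤ cbs * U * ((4 : ℝ) ^ nScales β) ^ s)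
    (hTc : ∀ m ≤ 4, ∀ (σ : Fin 2) (x₀ : SpaceTimeIdx L M), imagTimeWeight β M *
      ∑ x ∈ (univ : Finset (Fin 2 → SpaceTimeIdx L M)).filter (fun x => x 0 = x₀),
        (1 + ((((x 1).2 - (x 0).2) 0).valMinAbs.natAbs : ℝ) + ((((x 1).2 - (x 0).2) 1).valMinAbs.natAbs : ℝ)) ^ m * (imagTimeWeight β M * (circDist (2 * M) (x 0).1.val (x 1).1.val : ℝ)) *
          ‖sectorisedKernel L M β (trivialMultiplier L M) (klEffectiveAction L M β U μ (klFlowFrameU L M β U μ (nScales β + 1)) klE0 (nScales β + 1)) 2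
            (![((0, σ), 0), ((0, σ), 1)] : Fin 2 → SectorLeg 1) x‖ ≤ cc * U ^ 2 * ((4 : ℝ) ^ nScales β) ^ m)
    (hTcs : ∀ (σ : Fin 2) (x₀ : SpaceTimeIdx L M), imagTimeWeight β M *
      ∑ x ∈ (univ : Finset (Fin 2 → SpaceTimeIdx L M)).filter (fun x => x 0 = x₀),
        (1 + ((((x 1).2 - (x 0).2) 0).valMinAbs.natAbs : ℝ) + ((((x 1).2 - (x 0).2) 1).valMinAbs.natAbs : ℝ)) ^ s * (imagTimeWeight β M * (circDist (2 * M) (x 0).1.val (x 1).1.val : ℝ)) *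
          ‖sectorisedKernel L M β (trivialMultiplier L M) (klEffectiveAction L M β U μ (klFlowFrameU L M β U μ (nScales β + 1)) klE0 (nScales β + 1)) 2
            (![((0, σ), 0), ((0, σ), 1)] : Fin 2 → SectorLeg 1) x‖ ≤ ccs * U ^ 2 * ((4 : ℝ) ^ nScales β) ^ s)
    (hUlast : U ≤ klLastRespU P R) (hUE1 : 32 * klEngRsq R ^ 5 * (2 ^ 234 * cb + 2 ^ 156 * cc + cbs + ccs) * U ≤ 1)
    -- the (P)-receiver's other inputs at the last index (k3c3-p1 `twoLegRead_flow_succ_of_swap_lit_registered`, n := n_β)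
    (hLdeg : 4 * klFlowDeg (nScales β + 1) ≤ L) {cA cA' pc pc' : ℕ → ℝ} {τA a : ℝ} (hpc : ∀ k, 0 ≤ pc k) (hpc' : ∀ k, 0 ≤ pc' k)
    (hA : TwoLegCurveJetBound L M cA cA' β U μ (klFlowFrameU L M β U μ (nScales β)) (nScales β + 1))
    (hAval : ∀ θ : ℝ, |klTwoLegCurveProfile L M β U μ (klFlowFrameU L M β U μ (nScales β)) (nScales β + 1) θ - τA| ≤
      a * U ^ 2 * (4 : ℝ) ^ (-2 * ((nScales β + 1 : ℕ) : ℤ)))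
    -- (T): the #17 export at the LAST index `(K_{n_β+1}, n_β+1)`, five rows (factor `4^{j−1}`), a primed table above `transport_jets_flow_fit`'s
    {z : ℕ → ℝ} (hz : ∀ j, 0 ≤ z j) (hZsp : TwoLegDualSpaceMomentsUpToAt L M (klZspLaw z U (nScales β + 1)) β U μ (nScales β + 1) 5)
    {mT : ℕ → ℝ} (hmT : ∀ j, 0 ≤ mT j)
    (hmT1 : 4 / 3 * R.Gfr 1 + 2 * z 1 ≤ mT 1) (hmT2 : R.Gfr 2 + 8 * z 2 ≤ mT 2) (hmT3 : R.Gfr 3 / 3 + 32 * z 3 ≤ mT 3)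
    (hmT4 : R.Gfr 4 / 15 + 128 * z 4 ≤ mT 4) (hmT5 : 2 ^ 5 * (Real.pi ^ 8 / 4 * 2 ^ 4 * (2 : ℝ) ^ 32) * W / 63 + 512 * z 5 ≤ mT 5)
    {eT' : ℕ → ℝ} (heT : ∀ k ≤ 4,
        (fun k : ℕ =>
          if k = 0 then 16 * ((12.2 * R.Gfr 0 * mT 1))
          else if k = 1 then 4 * ((1420 * 2 * (R.Gfr 1 + R.Gfr 2 + R.Gfr 3 + R.Gfr 4) * (1 + 2 * (R.Gfr 3 + R.Gfr 4)) * mT 1) + (36400 * R.Gfr 0 * mT 1) + (2820 * R.Gfr 0 * mT 2))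
          else if k = 2 then ((12900000 * 2 ^ 2 * (R.Gfr 1 + R.Gfr 2 + R.Gfr 3 + R.Gfr 4) * (1 + 2 * (R.Gfr 3 + R.Gfr 4)) ^ 2 * mT 1) + (657000 * 2 * (R.Gfr 1 + R.Gfr 2 + R.Gfr 3 + R.Gfr 4) * (1 + 2 * (R.Gfr 3 + R.Gfr 4)) * mT 2) + (338000000 * 2 * R.Gfr 0 * (1 + 2 * (R.Gfr 3 + R.Gfr 4)) * mT 1) + (25400000 * R.Gfr 0 * mT 2) + (652000 * R.Gfr 0 * mT 3))
          else if k = 3 then ((199000000000 * 2 ^ 3 * (R.Gfr 1 + R.Gfr 2 + R.Gfr 3 + R.Gfr 4) * (1 + 2 * (R.Gfr 3 + R.Gfr 4)) ^ 3 * mT 1) + (12000000000 * 2 ^ 2 * (R.Gfr 1 + R.Gfr 2 + R.Gfr 3 + R.Gfr 4) * (1 + 2 * (R.Gfr 3 + R.Gfr 4)) ^ 2 * mT 2) + (228000000 * 2 * (R.Gfr 1 + R.Gfr 2 + R.Gfr 3 + R.Gfr 4) * (1 + 2 * (R.Gfr 3 + R.Gfr 4)) * mT 3) + (5230000000000 *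 2 ^ 2 * R.Gfr 0 * (1 + 2 * (R.Gfr 3 + R.Gfr 4)) ^ 2 * mT 1) + (392000000000 * 2 * R.Gfr 0 * (1 + 2 * (R.Gfr 3 + R.Gfr 4)) * mT 2) + (11800000000 * R.Gfr 0 * mT 3) + (151000000 * R.Gfr 0 * mT 4)) / 4
          else if k = 4 then ((4300000000000000 * 2 ^ 4 * (R.Gfr 1 + R.Gfr 2 + R.Gfr 3 + R.Gfr 4) * (1 + 2 * (R.Gfr 3 + R.Gfr 4)) ^ 4 * mT 1) + (276000000000000 * 2 ^ 3 * (R.Gfr 1 + R.Gfr 2 + R.Gfr 3 + R.Gfr 4) * (1 + 2 * (R.Gfr 3 + R.Gfr 4)) ^ 3 * mT 2) + (6890000000000 * 2 ^ 2 * (R.Gfr 1 + R.Gfr 2 + R.Gfr 3 + R.Gfr 4) * (1 + 2 * (R.Gfr 3 + R.Gfr 4)) ^ 2 * mT 3) + (70100000000 * 2 * (R.Gfr 1 + R.Gfr 2 + R.Gfr 3 + R.Gfr 4) * (1 + 2 * (R.Gfr 3 + R.Gfr 4)) * mT 4) + (114000000000000000 * 2 ^ 2 * R.Gfr 0 * (1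 + 2 * (R.Gfr 3 + R.Gfr 4)) ^ 2 * mT 1) + (8490000000000000 * 2 ^ 2 * R.Gfr 0 * (1 + 2 * (R.Gfr 3 + R.Gfr 4)) ^ 2 * mT 2) + (272000000000000 * 2 * R.Gfr 0 * (1 + 2 * (R.Gfr 3 + R.Gfr 4)) * mT 3) + (4530000000000 * R.Gfr 0 * mT 4) + (34800000000 * R.Gfr 0 * mT 5) + (69200000000 * (16 / 15) * R.Gfr 4 * mT 1)) / 16
          else 0) k ≤ eT' k)
    -- (C1): the cutoff-defect certificate of the table branch at degree `klFlowDeg n_β`, the PRIVATE induction hypothesis (jets half), tables above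
    {d : ℕ} (hd : klFlowDeg (nScales β) = d) {A : ℕ → ℝ} {T : CutoffDefectTable} (hcert : CutoffDefectCertFrame d A T) (hTd : 0 ≤ T.Td)
    (hN0 : 0 ≤ T.N0) (hA12 : ∀ j ≤ 4, (1 : ℝ) / 10 ^ 12 ≤ A j) (hIH : TwoLegReadJetBound L M pc pc' β U μ (klFlowFrameU L M β U μ (nScales β)) (nScales β))
    {eJ eJ' : ℕ → ℝ} (heJ0 : eJ 0 = 0)
    (heJ : ∀ k ≤ 4,
        (fun k => if k = 0 then 0 else
          (if k ≤ 3 then T.bound (fun l : ℕ => if l = 0 then π / 2 * pc 1 * (4 : ℝ) ^ ((((1 : ℕ) : ℤ) - 2) * (nScales β)) else pc l * (4 : ℝ) ^ (((l : ℤ) - 2) * (nScales β))) k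
            else T.boundNR (fun l : ℕ => if l = 0 then π / 2 * pc 1 * (4 : ℝ) ^ ((((1 : ℕ) : ℤ) - 2) * (nScales β)) else pc l * (4 : ℝ) ^ (((l : ℤ) - 2) * (nScales β))) k) *
            ((4 : ℝ) ^ (((k : ℤ) - 2) * (((nScales β) + 1 : ℕ) : ℤ)))⁻¹) k ≤ eJ k)
    (heJ' : ∀ k ≤ 4,
        (fun k => if k = 0 then (pc 1 + pc' 1) * (T.Td + π / 2 * T.N0) * (4 : ℝ) ^ ((((1 : ℕ) : ℤ) - 2) * (nScales β)) *
            ((4 : ℝ) ^ ((((0 : ℕ) : ℤ) - 2) * (((nScales β) + 1 : ℕ) : ℤ)))⁻¹ else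
          (if k ≤ 3 then T.bound (fun l : ℕ => if l = 0 then π / 2 * pc' 1 * (4 : ℝ) ^ ((((1 : ℕ) : ℤ) - 2) * (nScales β)) else pc' l * (4 : ℝ) ^ (((l : ℤ) - 2) * (nScales β))) k
            else T.boundNR (fun l : ℕ => if l = 0 then π / 2 * pc' 1 * (4 : ℝ) ^ ((((1 : ℕ) : ℤ) - 2) * (nScales β)) else pc' l * (4 : ℝ) ^ (((l : ℤ) - 2) * (nScales β))) k) *
            ((4 : ℝ) ^ (((k : ℤ) - 2) * (((nScales β) + 1 : ℕ) : ℤ)))⁻¹) k ≤ eJ' k)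
    (hfit : ∀ k, cA k + ((if k = 0 then (0 : ℝ) else 1) + eJ k) ≤ klC4aJetC2 k)
    (hfit' : ∀ k, cA' k + ((if k = 0 then (1 : ℝ) else 0) + eT' k + eJ' k) ≤ klC4aJetC' P R k)
    (hfitO : 2 * (a + (1 + eT' 0 + eJ' 0)) ≤ klReadOscC P R) :
    TwoLegReadJetBound L M klC4aJetC2 (klC4aJetC' P R) β U μ (klFlowFrameU L M β U μ (nScales β + 1)) (nScales β + 1) ∧
      TwoLegReadOscAt L M (klReadOscC P R) β U μ (klFlowFrameU L M β U μ (nScales β + 1)) (nScales β + 1) := by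
  have hR : ∀ j, 0 ≤ R.Gfr j := hRW.2.2
  have hcle : c ≤ klCurveC3 R := hc6.trans ((klEngC₃6_le_klEngC₃3 P R).trans (klEngC₃3_le_klCurveC3 P hR))
  have hUle : U ≤ klCurveU0 R := hU9.trans ((klEngU₀9_le_klEngU₀3 P R c).trans (klEngU₀3_le_klCurveU0 P hR c))
  have hU1 : U ≤ 1 := hUle.trans (klCurveU0_le_one R)
  obtain ⟨hJdiff, hJ0⟩ := readResidueC1_hJ_of_twoLegReadJetBound_klEng (L := L) (M := M) hRW hc hc6 hμ hU hU9 hβmin hβc hN21 hK1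
    (fun m hm => hPh m (by omega)) hd hcert hTd hN0 hA12 hpc hpc' hIH
  have hJ : ∀ k ≤ 4, ∀ θ : ℝ, |iteratedDeriv k (fun θ : ℝ => klLocalPart L M β U μ (klFlowFrameU L M β U μ (nScales β)) (nScales β) θ -
      (klFlowPiece L M β U μ (nScales β)).eval (klFermiPoint μ (klFlowFrameU L M β U μ (nScales β + 1)) θ)) θ| ≤
      curveJetBar eJ eJ' U k (nScales β + 1) :=
    fun k hk θ => (hJ0 k hk θ).trans (curveJetBar_mono_at (heJ k hk) (heJ' k hk))
  exact twoLegRead_flow_last_registered_of_pos_c2 hR hc hcle hU hU1 hUle hβmin hβc hμ hK hK1 hGS hQS hR0 hPh hT hW hΞ hΘ hdoor hL hZn hs hcb hcbs hcc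
    hccs hSb hSbs hTc hTcs hUlast hUE1 hLdeg hA hAval hz hZsp hmT hmT1 hmT2 hmT3 hmT4 hmT5 heT hJdiff hJ heJ0 hfit hfit' hfitO

end LastAllDoors

end Summit.HubbardSuperconductivity.HubbardSuperconductivity.Theorems.EngineV8

end
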